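import Literature.Probability.LatticeModels.MedialExplorationVertexEscape
import HarnessLib

/-!
# The winding at the touch darts of a straight boundary side is constant: the side functional and the
# detour identity

Topic `Literature/Probability/LatticeModels`; fifth instalment of the boundary-winding toolkit
(`MedialCornerTrailWinding`, `MedialExplorationPrefixWinding`, `MedialExplorationEscapeWinding`,
`MedialCornerWalk`, `MedialExplorationVertexEscape`). A TOUCH DART of orientation `j` is a corner `(u, j)` whose
vertex `u` is an interior site with its `(j+1)`-st and `(j+2)`-nd neighbours on the dual-wired arc; along a
straight (diagonal) boundary side the touch sites are `u, u + u_j + u_{j+1}, u + 2(u_j + u_{j+1}), …`. The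
escape of `(u, j)` used for the side runs `u → b₁ = u + u_{j+1} → w = b₁ + u_{j+2} → o = w + u_{j+2}` (out of
the domain) and then along the outside; the relevant extreme direction is the SIDE FUNCTIONAL `sideVal j` of
the medial coordinates (`t, -s, -t, s` for `j = 0, 1, 2, 3`), maximised by an outside corner of index `j + 3`.

* `sideVal`, `turnCount_eq_of_vertexEscape_side` — the four extreme-dart criteria of
  `MedialExplorationVertexEscape.lean` as ONE statement indexed by the orientation `j`: a corner of the escape
  list of index `j + 3` maximising `sideVal j` over inner-face corners and over the escape list gives
  `turnCount = -4 - (walkTurns j ds + 1)`;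
* `walkTurns_detour` — **the detour identity**: the escape of the touch site `u` that first steps out and
  then joins, two lattice steps later, the escape of the next touch site `u' = u + u_j + u_{j+1}` has the same
  signed turning: `walkTurns j ([j+1, j+2, j+2, j+1, j] ++ T) = walkTurns j ([j+1, j+2, j+2] ++ T)` whenever the
  common tail `T` starts with `j + 1`;
* `turnCount_eq_of_detourEscape` — hence the winding at `(u, j)`, computed through the detour, is the value
  `-4 - (walkTurns j ([j+1, j+2, j+2] ++ T) + 1)` attached to the NEXT touch site: along a straight side all
  touch darts of orientation `j` carry the same (configuration-independent) winding. This is the lattice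
  content of "the winding `W_γ(e_a, e)` at a free-arc edge is constant" (Duminil-Copin–Hongler–Nolin 2011,
  Lemma 12; Duminil-Copin 2013, Prop. 5) for the tree's medial exploration.

Everything is proved; the geometric hypotheses (forbidden vertices, no repeated vertex, the extreme corner)
are the caller's, to be discharged from the lattice geometry of the domain at hand.

## References

* H. Duminil-Copin, C. Hongler, P. Nolin, Comm. Pure Appl. Math. 64 (2011), Lemma 12.
  [DuminilCopinHonglerNolin2011]
-/

namespace Literature.Probability.LatticeModels

open MedialTrail Finset DiscreteDobrushin

variable {D : DiscreteDobrushin}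

/-! ### The side functional -/

/-- The SIDE FUNCTIONAL of orientation `j` on medial coordinates `(s, t)`: `t, -s, -t, s` for `j = 0, 1, 2, 3`
(the outward direction across a boundary side whose touch darts have orientation `j`).
[cite: DuminilCopinHonglerNolin2011, Lemma 12] -/
def sideVal (j : Fin 4) (P : ℤ × ℤ) : ℤ := ![P.2, -P.1, -P.2, P.1] j

/-- **The winding at a corner with a vertex escape, extreme corner for the side functional.** If a corner
`d` of the escape list has index `j + 3` and maximises `sideVal j ∘ cpos` over all corners with an inner face
and over the escape list, then at every passage of `(u, j)` before the exit
`turnCount = -4 - (walkTurns j ds + 1)`. [cite: DuminilCopinHonglerNolin2011, Lemma 12] -/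
theorem turnCount_eq_of_vertexEscape_side (hD : D.IsZdAdmissible) {u : Site 2} {j : Fin 4} {ds : List (Fin 4)}
    (hhead : ds.head? = some (j + 1)) (hend : pathEnd u ds = (startCorner hD).1)
    (hlast : lastDir ds = (startCorner hD).2 + 1)
    (hforb : ∀ v ∈ (pathVerts u ds).tail, (∀ i : Fin 4, ¬ D.IsInnerFace (faceAt v i)) ∨ v ∈ D.zdArcB)
    (hnodup : (pathVerts u ds ++ [(startCorner hD).1]).Nodup)
    {d : Site 2 × Fin 4} (hd : d ∈ escapeList hD u j ds) (hidx : d.2 = j + 3)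
    (hI : ∀ p : Site 2 × Fin 4, D.IsInnerFace (cFace p) → sideVal j (cpos p) ≤ sideVal j (cpos d))
    (hE : ∀ d' ∈ escapeList hD u j ds, sideVal j (cpos d') ≤ sideVal j (cpos d))
    (ω : Percolation.BondConfig (Site 2)) {t : ℕ} (ht : t < exitTime hD ω)
    (horb : cornerOrbit (D.bcBondConfig ω) (startCorner hD) t = (u, j)) :
    turnCount (D.bcBondConfig ω) (startCorner hD) t = -4 - (walkTurns j ds + 1) := by
  fin_cases j
  · simp only [sideVal, Fin.zero_eta, Matrix.cons_val_zero] at hI hE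
    exact turnCount_eq_of_vertexEscape_top_east hD hhead hend hlast hforb hnodup hd hidx hI hE ω ht horb
  · simp only [sideVal, Fin.mk_one, Matrix.cons_val_one, Matrix.cons_val_zero, neg_le_neg_iff] at hI hE
    exact turnCount_eq_of_vertexEscape_west_north hD hhead hend hlast hforb hnodup hd hidx hI hE ω ht horb
  · simp only [sideVal, Fin.reduceFinMk, Matrix.cons_val, neg_le_neg_iff] at hI hE
    exact turnCount_eq_of_vertexEscape_bot_west hD hhead hend hlast hforb hnodup hd hidx hI hE ω ht horb
  · simp only [sideVal, Fin.reduceFinMk, Matrix.cons_val] at hI hE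
    exact turnCount_eq_of_vertexEscape_east_south hD hhead hend hlast hforb hnodup hd hidx hI hE ω ht horb

/-! ### The detour identity -/

/-- The signed turns of the first three steps of a touch escape: `walkTurns j [j+1, j+2, j+2] = 0`, and the
walk continues entered at `j` (from direction `j + 2`). [folklore] -/
theorem walkTurns_touchPrefix (j : Fin 4) (T : List (Fin 4)) :
    walkTurns j ([j + 1, j + 2, j + 2] ++ T) = walkTurns j T := by
  have h := walkTurns_append j [j + 1, j + 2] (j + 2) T
  simp only [List.cons_append, List.nil_append] at h ⊢
  rw [h]
  have key : ∀ j : Fin 4, walkTurns j [j + 1, j + 2, j + 2] = 0 ∧ j + 2 + 2 = j := by decide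
  rw [(key j).1, (key j).2, zero_add]

/-- The signed turns of the five-step detour `[j+1, j+2, j+2, j+1, j]`: `-2`, and the walk continues entered
at `j + 2` (from direction `j`). [folklore] -/
theorem walkTurns_detourPrefix (j : Fin 4) (T : List (Fin 4)) :
    walkTurns j ([j + 1, j + 2, j + 2, j + 1, j] ++ T) = -2 + walkTurns (j + 2) T := by
  have h := walkTurns_append j [j + 1, j + 2, j + 2, j + 1] j T
  simp only [List.cons_append, List.nil_append] at h ⊢
  rw [h]
  have key : ∀ j : Fin 4, walkTurns j [j + 1, j + 2, j + 2, j + 1, j] = -2 := by decide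
  rw [key]

/-- **The detour identity.** If the common tail starts with the direction `j + 1`, the detour escape and the
direct escape have the same signed turning. [cite: DuminilCopinHonglerNolin2011, Lemma 12] -/
theorem walkTurns_detour (j : Fin 4) {T : List (Fin 4)} (hT : T.head? = some (j + 1)) :
    walkTurns j ([j + 1, j + 2, j + 2, j + 1, j] ++ T) = walkTurns j ([j + 1, j + 2, j + 2] ++ T) := by
  obtain ⟨T', rfl⟩ : ∃ T', T = (j + 1) :: T' := by
    rcases T with _ | ⟨d, T'⟩
    · simp at hT
    · simp only [List.head?_cons, Option.some.injEq] at hT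
      exact ⟨T', by rw [hT]⟩
  rw [walkTurns_detourPrefix, walkTurns_touchPrefix, walkTurns, walkTurns]
  have key : ∀ j : Fin 4, (((j + 1 + 3 - (j + 2)).val : ℕ) : ℤ) = 2 ∧ (((j + 1 + 3 - j).val : ℕ) : ℤ) = 0 := by decide
  rw [(key j).1, (key j).2]
  ring

/-- **The winding at a touch dart through the detour is the value of the next touch site.** For the escape
of `(u, j)` along `u → u + u_{j+1} → ⋯` stepping out, turning back and joining (at `o'`, entered from
direction `j`) a tail `T` that starts with `j + 1`, the turn count at every passage of `(u, j)` is
`-4 - (walkTurns j ([j+1, j+2, j+2] ++ T) + 1)` — the value the direct escape `[j+1, j+2, j+2] ++ T` gives at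
the next touch site `u + u_j + u_{j+1}` (`turnCount_eq_of_vertexEscape_side`).
[cite: DuminilCopinHonglerNolin2011, Lemma 12] -/
theorem turnCount_eq_of_detourEscape (hD : D.IsZdAdmissible) {u : Site 2} {j : Fin 4} {T : List (Fin 4)}
    (hT : T.head? = some (j + 1))
    (hend : pathEnd u ([j + 1, j + 2, j + 2, j + 1, j] ++ T) = (startCorner hD).1)
    (hlast : lastDir ([j + 1, j + 2, j + 2, j + 1, j] ++ T) = (startCorner hD).2 + 1)
    (hforb : ∀ v ∈ (pathVerts u ([j + 1, j + 2, j + 2, j + 1, j] ++ T)).tail,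
      (∀ i : Fin 4, ¬ D.IsInnerFace (faceAt v i)) ∨ v ∈ D.zdArcB)
    (hnodup : (pathVerts u ([j + 1, j + 2, j + 2, j + 1, j] ++ T) ++ [(startCorner hD).1]).Nodup)
    {d : Site 2 × Fin 4} (hd : d ∈ escapeList hD u j ([j + 1, j + 2, j + 2, j + 1, j] ++ T)) (hidx : d.2 = j + 3)
    (hI : ∀ p : Site 2 × Fin 4, D.IsInnerFace (cFace p) → sideVal j (cpos p) ≤ sideVal j (cpos d))
    (hE : ∀ d' ∈ escapeList hD u j ([j + 1, j + 2, j + 2, j + 1, j] ++ T), sideVal j (cpos d') ≤ sideVal j (cpos d))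
    (ω : Percolation.BondConfig (Site 2)) {t : ℕ} (ht : t < exitTime hD ω)
    (horb : cornerOrbit (D.bcBondConfig ω) (startCorner hD) t = (u, j)) :
    turnCount (D.bcBondConfig ω) (startCorner hD) t = -4 - (walkTurns j ([j + 1, j + 2, j + 2] ++ T) + 1) := by
  rw [← walkTurns_detour j hT]
  exact turnCount_eq_of_vertexEscape_side hD rfl hend hlast hforb hnodup hd hidx hI hE ω ht horb

end Literature.Probability.LatticeModels
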